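import Summits.CriticalPhenomena.PercolationContinuityZ3.Theorems.Transplant.FKDoubleFanFanExchange
import HarnessLib

/-!
# Double fans `K₂ ∨ P_{m+1}`: the MULTIFAN₁ cone has EXOTIC faces — a valid input bivector that passes every plain-target test and yet leaves the
# cone under ONE rim step; `DualAB` is not generated by plain targets

Helper file (`--supports stmt-CriticalPhenomena-4575`), FK sub-lane `prim-bschramm-fk-3` (gen 47); builds on p205010 (kernel theorem, internal audit
signed; external expert review pending).  No named facts, no sorries; standard axioms.  Memo `bschramm/prim-bschramm-fk-3/FAR-CROSS-XXII.md` §0(F).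

CONTEXT.  In the cone route to the far cross-apex theorem (`…MultifanCone`, `…CrossPosEasy`, `…FanExchange`) the open hypothesis `HypAC` (an `a`-spoke keeps
`coneAB` invariant) is automatic at every face of `coneAB` cut out by a PLAIN target `(s∗BC_0)∧(s∗BC_1)`, by a sign functional or by a `C3` facet
(`…CrossPosEasy`), and the numerical boundary atlases of gen 45 met no other faces.  This file shows that other ("exotic") faces nevertheless EXIST, so the
face-by-face argument cannot exhaust `HypAC`.
* **`pairH_input_target_eq`**: the depth-0 pairing in hat products, `⟪u∧P_a u, s∧P_b s⟫ = (1−q)·[x̂v̂·x̂'v̂' + (1−q)ŷẑ·ŷ'ẑ' − (2−q)ûv̂·û'v̂']`, and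
  **`pairH_input_target_eq_cert`**: the same as `(1−q)·[N N' + N(c'+(1−q)K') + N'(c+(1−q)K) + (1−q)(2−q)K K']` with `N = N^{(ab)}`, `K = κ_ab = kap∘swapBC`,
  `c = ûv̂` of `u` resp. `s` — hence (**`pairH_input_target_nonneg`**) `≥ 0` as soon as `u` and `s` have non-negative masses, `N^{(ab)} ≥ 0` and `κ_ab ≥ 0`
  (in particular for all `u, s ∈ Valid q`; the `U`-conditions are NOT needed at depth 0).
* THE WITNESS (`q = 1/2`): `uW = (1, 1/4, 1/3, 1/12, 1/3)` is `Valid` (**`valid_uW`**; it violates `U_b`, not needed here), so its input bivector passes every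
  plain-target test (**`pairH_inputW_target_nonneg`**, all `s ∈ Valid (1/2)`, a fortiori all `s ∈ InKE`); but after the rim step `E_{1/10}` it pairs NEGATIVELY
  with the plain target of `sW = AC_{11/12} ∗ δ₀ ∈ InKE`: **`pairH_opE_inputW_targetW`** `= −11/172800`.
* CONSEQUENCES (`q = 1/2`): (**`inputW_not_mem_coneAB`**) the input bivector of the valid vector `uW` is NOT in `coneAB` (the cone is `E`-stable and pairs `≥ 0`
  with targets) — validity of the prefix is not sufficient for membership; (**`not_opE_stable_targetPositive`**) the closed convex cone
  `{β | ∀ s ∈ InKE, ⟪β, (s∗BC_0)∧(s∗BC_1)⟫ ≥ 0}` of all bivectors passing the plain-target tests is NOT stable under `∧²E_{1/10}`; equivalently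
  (**`exists_dualAB_not_targetGenerated`**) the rim-step transport `∧²E_{1/10}ᵀ` of the plain target of `sW` is an element of `DualAB` that is negative
  on a bivector on which every plain target is non-negative — `DualAB (1/2)` is not contained in any cone whose elements are non-negative wherever all plain
  targets are; its extreme rays include transported targets, and `coneAB` has faces supported only by them.
[cite: Grimmett2006, §3.9 eq. (3.94) (pp. 63–64)] [folklore]
-/

noncomputable section

namespace Summit.CriticalPhenomena.PercolationContinuityZ3.Theorems

namespace FK

namespace ThreeApex

/-! ### The depth-0 pairing and its certificate -/

/-- **The depth-0 cross-apex pairing in hat products**: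
`⟪(AC_0∗u)∧(AC_1∗u), (s∗BC_0)∧(s∗BC_1)⟫ = (1−q)·[x̂v̂·x̂'v̂' + (1−q)·ŷẑ·ŷ'ẑ' − (2−q)·ûv̂·û'v̂']`. [folklore] -/
theorem pairH_input_target_eq (q : ℝ) (u s : V5) :
    pairH q (wedgeH (conv (edgeAC 0) u) (conv (edgeAC 1) u)) (wedgeH (conv s (edgeBC 0)) (conv s (edgeBC 1))) =
      (1 - q) * (hx u * u.total * (hx s * s.total) + (1 - q) * (hy u * hz u) * (hy s * hz s)
        - (2 - q) * (u.z0 * u.total) * (s.z0 * s.total)) := by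
  simp only [pairH, wedgeH, conv, edgeAC, edgeBC, hx, hy, hz, V5.total]
  ring

/-- **Product-form certificate of the depth-0 pairing**: with `N = N^{(ab)} = masterN q ∘ swapBC`, `K = κ_ab = kap ∘ swapBC`, `c = ûv̂`,
`x̂v̂x̂'v̂' + (1−q)ŷẑŷ'ẑ' − (2−q)ûv̂û'v̂' = N N' + N(c' + (1−q)K') + N'(c + (1−q)K) + (1−q)(2−q)K K'`. [folklore] -/
theorem pairH_input_target_eq_cert (q : ℝ) (u s : V5) :
    pairH q (wedgeH (conv (edgeAC 0) u) (conv (edgeAC 1) u)) (wedgeH (conv s (edgeBC 0)) (conv s (edgeBC 1))) =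
      (1 - q) * (masterN q (swapBC u) * masterN q (swapBC s)
        + masterN q (swapBC u) * (s.z0 * s.total + (1 - q) * kap (swapBC s))
        + masterN q (swapBC s) * (u.z0 * u.total + (1 - q) * kap (swapBC u))
        + (1 - q) * (2 - q) * kap (swapBC u) * kap (swapBC s)) := by
  rw [pairH_input_target_eq]
  simp only [masterN, kap, swapBC, hx, hy, hz, V5.total]
  ring

/-- **The depth-0 pairing is non-negative** for `0 ≤ q ≤ 1` whenever `u` and `s` have non-negative masses, `N^{(ab)} ≥ 0` and `κ_ab ≥ 0` — no `U`-condition is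
needed at depth 0. [folklore] -/
theorem pairH_input_target_nonneg {q : ℝ} (hq1 : q ≤ 1) {u s : V5} (hu : u.Nonneg) (hs : s.Nonneg)
    (hNu : 0 ≤ masterN q (swapBC u)) (hNs : 0 ≤ masterN q (swapBC s)) (hKu : 0 ≤ kap (swapBC u)) (hKs : 0 ≤ kap (swapBC s)) :
    0 ≤ pairH q (wedgeH (conv (edgeAC 0) u) (conv (edgeAC 1) u)) (wedgeH (conv s (edgeBC 0)) (conv s (edgeBC 1))) := by
  rw [pairH_input_target_eq_cert]
  obtain ⟨u0, u1, u2, u3, u4⟩ := hu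
  obtain ⟨s0, s1, s2, s3, s4⟩ := hs
  have hut : 0 ≤ u.total := by simp only [V5.total]; linarith
  have hst : 0 ≤ s.total := by simp only [V5.total]; linarith
  have hp : 0 ≤ 1 - q := by linarith
  have hp2 : 0 ≤ 2 - q := by linarith
  have h1 : 0 ≤ s.z0 * s.total + (1 - q) * kap (swapBC s) := by positivity
  have h2 : 0 ≤ u.z0 * u.total + (1 - q) * kap (swapBC u) := by positivity
  have h3 : 0 ≤ masterN q (swapBC u) * masterN q (swapBC s) := mul_nonneg hNu hNs
  have h4 : 0 ≤ masterN q (swapBC u) * (s.z0 * s.total + (1 - q) * kap (swapBC s)) := mul_nonneg hNu h1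
  have h5 : 0 ≤ masterN q (swapBC s) * (u.z0 * u.total + (1 - q) * kap (swapBC u)) := mul_nonneg hNs h2
  have h6 : 0 ≤ (1 - q) * (2 - q) * kap (swapBC u) * kap (swapBC s) := by positivity
  exact mul_nonneg hp (by linarith)

/-- In particular the depth-0 pairing is non-negative for all valid `u, s` (`0 ≤ q ≤ 1`). [folklore] -/
theorem pairH_input_target_nonneg_of_valid {q : ℝ} (hq1 : q ≤ 1) {u s : V5} (hu : Valid q u) (hs : Valid q s) :
    0 ≤ pairH q (wedgeH (conv (edgeAC 0) u) (conv (edgeAC 1) u)) (wedgeH (conv s (edgeBC 0)) (conv s (edgeBC 1))) :=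
  pairH_input_target_nonneg hq1 hu.nonneg hs.nonneg hu.nAB hs.nAB hu.kapB hs.kapB

/-! ### The witness at `q = 1/2` -/

/-- The valid (but not `U_b`) prefix vector `uW = (1, 1/4, 1/3, 1/12, 1/3)`. [folklore] -/
def uW : V5 := ⟨1, 1 / 4, 1 / 3, 1 / 12, 1 / 3⟩

/-- The suffix `sW = AC_{11/12} ∗ δ₀ = (1/12, 0, 11/12, 0, 0)`. [folklore] -/
def sW : V5 := conv (edgeAC (11 / 12)) delta0

/-- `sW` in coordinates. [folklore] -/
theorem sW_eq : sW = ⟨1 / 12, 0, 11 / 12, 0, 0⟩ := by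
  ext <;> norm_num [sW, conv, edgeAC, delta0, V5.total]

/-- `sW ∈ InKE q` for every `q`. [folklore] -/
theorem inKE_sW (q : ℝ) : InKE q sW :=
  InKE.step (IsLetter.ac (by norm_num) (by norm_num)) InKE.base

/-- **`uW` is valid at `q = 1/2`** (all eight inequalities; it violates `U_b`, which is not claimed). [folklore] -/
theorem valid_uW : Valid (1 / 2) uW := by
  refine ⟨⟨?_, ?_, ?_, ?_, ?_⟩, ?_, ?_, ?_, ?_, ?_, ?_, ?_⟩ <;>
    norm_num [uW, masterN, lam, kap, swapBC, swapAB]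

/-- The input bivector of `uW`. [folklore] -/
def inputW : Biv := wedgeH (conv (edgeAC 0) uW) (conv (edgeAC 1) uW)

/-- The plain target of `sW`. [folklore] -/
def targetW : Biv := wedgeH (conv sW (edgeBC 0)) (conv sW (edgeBC 1))

/-- `inputW` in hat–Plücker coordinates. [folklore] -/
theorem inputW_eq : inputW = ⟨0, 4 / 3, 0, 2, 5 / 3, 0, 5 / 2, -13 / 9, 0, 13 / 6⟩ := by
  ext <;> norm_num [inputW, uW, wedgeH, conv, edgeAC, hx, hy, hz, V5.total]

/-- `targetW` in hat–Plücker coordinates. [folklore] -/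
theorem targetW_eq : targetW = ⟨0, 0, 1 / 144, 1 / 12, 0, 1 / 144, 1 / 12, 1 / 12, 1, 0⟩ := by
  ext <;> norm_num [targetW, sW_eq, wedgeH, conv, edgeBC, hx, hy, hz, V5.total]

/-- **Every plain-target test is passed**: `⟪inputW, (s∗BC_0)∧(s∗BC_1)⟫ ≥ 0` for every valid `s` at `q = 1/2` (a fortiori every `s ∈ InKE (1/2)`). [folklore] -/
theorem pairH_inputW_target_nonneg {s : V5} (hs : Valid (1 / 2) s) :
    0 ≤ pairH (1 / 2) inputW (wedgeH (conv s (edgeBC 0)) (conv s (edgeBC 1))) :=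
  pairH_input_target_nonneg_of_valid (by norm_num) valid_uW hs

/-- The same for `s ∈ InKE (1/2)`. [folklore] -/
theorem pairH_inputW_target_nonneg_inKE {s : V5} (hs : InKE (1 / 2) s) :
    0 ≤ pairH (1 / 2) inputW (wedgeH (conv s (edgeBC 0)) (conv s (edgeBC 1))) :=
  pairH_inputW_target_nonneg (hs.valid (by norm_num) (by norm_num))

/-- **After one rim step the plain-target test FAILS**: `⟪∧²E_{1/10}·inputW, targetW⟫ = −11/172800` at `q = 1/2`. [folklore] -/
theorem pairH_opE_inputW_targetW : pairH (1 / 2) (opE (1 / 2) (1 / 10) inputW) targetW = -11 / 172800 := by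
  rw [inputW_eq, targetW_eq]
  norm_num [pairH, opE, opTD, opWD, formD, Biv.lin3, Biv.add, Biv.smul]

/-- Hence the pairing is negative. [folklore] -/
theorem pairH_opE_inputW_targetW_neg : pairH (1 / 2) (opE (1 / 2) (1 / 10) inputW) targetW < 0 := by
  rw [pairH_opE_inputW_targetW]; norm_num

/-! ### Consequences -/

/-- **A valid input bivector outside the MULTIFAN₁ cone** (`q = 1/2`): `inputW ∉ coneAB (1/2)` — `coneAB` is stable under rim steps and pairs `≥ 0` with plain
targets, but `∧²E_{1/10}·inputW` does not.  (So the `U`-condition on prefixes is genuinely needed: validity does not suffice.) [folklore] -/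
theorem inputW_not_mem_coneAB : inputW ∉ coneAB (1 / 2) := by
  intro h
  have h1 : opE (1 / 2) (1 / 10) inputW ∈ coneAB (1 / 2) := coneAB_opE h (by norm_num) (by norm_num)
  have h2 : 0 ≤ pairH (1 / 2) (opE (1 / 2) (1 / 10) inputW) targetW :=
    pairH_coneAB_target (by norm_num) (by norm_num) (inKE_sW (1 / 2)) _ h1
  linarith [pairH_opE_inputW_targetW_neg]

/-- **The cone of all bivectors passing the plain-target tests is NOT rim-step stable** (`q = 1/2`): some `β` pairs `≥ 0` with every plain target
`(s∗BC_0)∧(s∗BC_1)`, `s ∈ InKE`, while `∧²E_{1/10}β` pairs negatively with one of them.  Hence no cone sandwiched between `coneAB` and this cone and defined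
by plain-target (and sign) inequalities alone can be a letter cone: the faces of `coneAB` are not all supported by plain targets. [folklore] -/
theorem not_opE_stable_targetPositive :
    ∃ β : Biv, (∀ s : V5, InKE (1 / 2) s → 0 ≤ pairH (1 / 2) β (wedgeH (conv s (edgeBC 0)) (conv s (edgeBC 1)))) ∧
      ∃ s : V5, InKE (1 / 2) s ∧ pairH (1 / 2) (opE (1 / 2) (1 / 10) β) (wedgeH (conv s (edgeBC 0)) (conv s (edgeBC 1))) < 0 :=
  ⟨inputW, fun _ hs => pairH_inputW_target_nonneg_inKE hs, sW, inKE_sW _, pairH_opE_inputW_targetW_neg⟩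

/-- **`DualAB` is not generated by plain targets** (`q = 1/2`): the transported target `∧²E_{1/10}ᵀ·targetW` (an element of `DualAB`, `DualAB.rim`) is negative
on a bivector on which every plain target is non-negative — so it lies outside every cone of functionals that are non-negative wherever all plain targets are,
in particular outside the closed convex cone generated by the plain targets. [folklore] -/
theorem exists_dualAB_not_targetGenerated :
    ∃ γ : Biv, DualAB (1 / 2) γ ∧ ∃ β : Biv,
      (∀ s : V5, InKE (1 / 2) s → 0 ≤ pairH (1 / 2) β (wedgeH (conv s (edgeBC 0)) (conv s (edgeBC 1)))) ∧ pairH (1 / 2) β γ < 0 := by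
  refine ⟨opE (1 / 2) (1 / 10) targetW, ?_, inputW, fun _ hs => pairH_inputW_target_nonneg_inKE hs, ?_⟩
  · exact (target_dualAB (by norm_num) (by norm_num) (inKE_sW (1 / 2))).rim (by norm_num) (by norm_num)
  · rw [← pairH_opE]; exact pairH_opE_inputW_targetW_neg

end ThreeApex

end FK

end Summit.CriticalPhenomena.PercolationContinuityZ3.Theorems
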